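import Summits.SmoothPoincare4.SmoothPoincare4.Theses.CylinderEntropy
import Summits.SmoothPoincare4.SmoothPoincare4.Theorems.CylinderEntropyThinCrossSectionExistsOfMassSlack
import Summits.SmoothPoincare4.SmoothPoincare4.Theorems.CylinderEntropySliceCalibration
import HarnessLib

/-!
# `ThinCrossSectionExists` ⇐ `MassSlackIntr`, unconditionally (line `ball-mass-slack`, lead-1 cycle 1)

Crux E = `CylinderEntropy.ThinCrossSectionExists` (`stmt-SmoothPoincare4-7633`).  Lead-0 landed the reduction
`thinCrossSectionExists_of_massSlackIntr : D → (λ_cyl(slice₀) ≤ 1) → E` (file `…ThinCrossSectionExistsOfMassSlack`, p95451),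
where D = `stub_massSlackIntr` is the line's ball-mass supply (every homotopy 4-sphere has a smooth end-separating
cross-section embedding into `N = S⁴×ℝ` with `Λ`-subspherical intrinsic ball mass for some `Λ < 4/e`).  Lead-1's reshape
registered the calibration as three stubs K1 `stub_funkHeckeVanishing` (p96785), K2 `stub_zonalSphereIntegral` (p97290),
K3 `stub_sliceDensity` (p96858), all landed, whence `cylEntropy_slice₀_le_one` / `SliceCalibration_proof`
(file `…CylinderEntropySliceCalibration`).  This file discharges the calibration hypothesis everywhere in the sandwich:

* `crux_of_massSlackIntr` — **E ⇐ D** with NO side hypothesis (the registered composition of the line: the crux is now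
  literally parked on D);
* `crux_of_smoothPoincare4` — **E ⇐ SPC4** unconditionally (the slice through the diffeomorphism; previously known only
  modulo `SliceCalibration`, cf. `Negative.crux_of_spc4`);
* `nonempty_diffeomorph_of_ballMass_of_rungTwo` — **D-instance ∧ R ⇒ standard** given only the sibling crux
  `CylinderRungTwo` (R, 7631).

So, kernel-checked and hypothesis-free: `SPC4 ⇒ D ⇒ E` and `D ∧ R ⇒ SPC4` (pointwise in `M`); with the route's `closes`
(`E ∧ R ⇒ SPC4`) the three statements D, E, SPC4 coincide modulo R.  Pure logic over landed files; no definitions, no facts.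
-/

noncomputable section

open scoped BigOperators Topology Manifold MeasureTheory ENNReal NNReal ContDiff ContinuousMap
open Set Function MeasureTheory
open Literature.Geometry.Riemannian.SphericalCylinderEntropy (cylEntropy)

set_option linter.dupNamespace false

namespace Summit.SmoothPoincare4.SmoothPoincare4.Theorems.ThinCrossSectionExists.BallMassSlack

open Summit.SmoothPoincare4.SmoothPoincare4.Theses.CylinderEntropy (ThinCrossSectionExists CylinderRungTwo)

/-- **E ⇐ D (no side hypothesis).**  The ball-mass supply D of line `ball-mass-slack` implies the crux
`ThinCrossSectionExists`: D's own cross-section has `λ_cyl ≤ Λ·λ_cyl(slice₀) ≤ Λ < 4/e` by the lever and the landed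
calibration `λ_cyl(slice₀) ≤ 1`. [folklore] -/
theorem crux_of_massSlackIntr :
    (∀ (M : Type) [TopologicalSpace M] [T2Space M] [SecondCountableTopology M]
      [ChartedSpace (EuclideanSpace ℝ (Fin 4)) M] [IsManifold (𝓡 4) ∞ M],
      M ≃ₕ (Metric.sphere (0 : EuclideanSpace ℝ (Fin 5)) 1) →
      ∃ ι : M → EuclideanSpace ℝ (Fin 6), Manifold.IsSmoothEmbedding (𝓡 4) (𝓡 6) ∞ ι ∧
        (∀ x, ∑ i : Fin 5, ι x (Fin.castSucc i) ^ 2 = 1) ∧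
        (∃ R : ℝ, ∀ a b : EuclideanSpace ℝ (Fin 6), ∑ i : Fin 5, a (Fin.castSucc i) ^ 2 = 1 → ∑ i : Fin 5, b (Fin.castSucc i) ^ 2 = 1 → a 5 ≤ -R → R ≤ b 5 →
          ¬ JoinedIn ({z : EuclideanSpace ℝ (Fin 6) | ∑ i : Fin 5, z (Fin.castSucc i) ^ 2 = 1} \ Set.range ι) a b) ∧
        ∃ Λ : ℝ≥0∞, Λ < ENNReal.ofReal (4 / Real.exp 1) ∧
          ∀ p : EuclideanSpace ℝ (Fin 6), ∑ i : Fin 5, p (Fin.castSucc i) ^ 2 = 1 → ∀ r : ℝ, 0 < r →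
          μH[4] (Set.range ι ∩ {y : EuclideanSpace ℝ (Fin 6) | ∑ i : Fin 5, y (Fin.castSucc i) ^ 2 = 1 ∧ Real.arccos (∑ i : Fin 5, y (Fin.castSucc i) * p (Fin.castSucc i)) ^ 2 + (y 5 - p 5) ^ 2 ≤ r ^ 2}) ≤
            Λ * μH[4] ({z : EuclideanSpace ℝ (Fin 6) | ∑ i : Fin 5, z (Fin.castSucc i) ^ 2 = 1 ∧ z 5 = 0} ∩
              {y : EuclideanSpace ℝ (Fin 6) | ∑ i : Fin 5, y (Fin.castSucc i) ^ 2 = 1 ∧ Real.arccos (∑ i : Fin 5, y (Fin.castSucc i) * (EuclideanSpace.single 0 1 : EuclideanSpace ℝ (Fin 6)) (Fin.castSucc i)) ^ 2 + (y 5 - (EuclideanSpace.single 0 1 : EuclideanSpace ℝ (Fin 6)) 5) ^ 2 ≤ r ^ 2})) →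
    Summit.SmoothPoincare4.SmoothPoincare4.Theses.CylinderEntropy.ThinCrossSectionExists :=
  fun hD =>
  thinCrossSectionExists_of_massSlackIntr hD Summit.SmoothPoincare4.SmoothPoincare4.Theorems.cylEntropy_slice₀_le_one

/-- **E ⇐ SPC4, unconditionally**: if every homotopy 4-sphere is diffeomorphic to `S⁴` then every homotopy 4-sphere has a
thin cross-section (the slice through the diffeomorphism: `massSlackIntr_of_spc4` then `crux_of_massSlackIntr`).  The known
half of the sandwich `E ⇔ SPC4 (mod R)`, now free of the calibration hypothesis. [folklore] -/
theorem crux_of_smoothPoincare4 (h : _root_.SmoothPoincare4) : ThinCrossSectionExists :=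
  crux_of_massSlackIntr (massSlackIntr_of_spc4 h)

/-- **D-instance ∧ R ⇒ standard** (calibration discharged): given the recognition crux R (`CylinderRungTwo`, item 7631), a
homotopy 4-sphere realised in `N` by a smooth end-separating embedding whose image has `Λ`-subspherical intrinsic ball mass for
some `Λ < 4/e` is diffeomorphic to `S⁴` — the only known way D implies SPC4. [folklore] -/
theorem nonempty_diffeomorph_of_ballMass_of_rungTwo (hR : CylinderRungTwo)
    (M : Type) [TopologicalSpace M] [T2Space M] [SecondCountableTopology M]
    [ChartedSpace (EuclideanSpace ℝ (Fin 4)) M] [IsManifold (𝓡 4) ∞ M]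
    (e : M ≃ₕ (Metric.sphere (0 : EuclideanSpace ℝ (Fin 5)) 1))
    (ι : M → EuclideanSpace ℝ (Fin 6)) (hι : Manifold.IsSmoothEmbedding (𝓡 4) (𝓡 6) ∞ ι)
    (hN : ∀ x, ∑ i : Fin 5, ι x (Fin.castSucc i) ^ 2 = 1)
    (hsep : ∃ R : ℝ, ∀ a b : EuclideanSpace ℝ (Fin 6), ∑ i : Fin 5, a (Fin.castSucc i) ^ 2 = 1 → ∑ i : Fin 5, b (Fin.castSucc i) ^ 2 = 1 → a 5 ≤ -R → R ≤ b 5 →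
      ¬ JoinedIn ({z : EuclideanSpace ℝ (Fin 6) | ∑ i : Fin 5, z (Fin.castSucc i) ^ 2 = 1} \ Set.range ι) a b)
    {Λ : ℝ≥0∞} (hΛ : Λ < ENNReal.ofReal (4 / Real.exp 1))
    (hmass : ∀ q : EuclideanSpace ℝ (Fin 6), ∑ i : Fin 5, q (Fin.castSucc i) ^ 2 = 1 → ∀ r : ℝ, 0 < r →
      μH[4] (Set.range ι ∩ {y : EuclideanSpace ℝ (Fin 6) | ∑ i : Fin 5, y (Fin.castSucc i) ^ 2 = 1 ∧ Real.arccos (∑ i : Fin 5, y (Fin.castSucc i) * q (Fin.castSucc i)) ^ 2 + (y 5 - q 5) ^ 2 ≤ r ^ 2}) ≤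
        Λ * μH[4] ({z : EuclideanSpace ℝ (Fin 6) | ∑ i : Fin 5, z (Fin.castSucc i) ^ 2 = 1 ∧ z 5 = 0} ∩
          {y : EuclideanSpace ℝ (Fin 6) | ∑ i : Fin 5, y (Fin.castSucc i) ^ 2 = 1 ∧ Real.arccos (∑ i : Fin 5, y (Fin.castSucc i) * (EuclideanSpace.single 0 1 : EuclideanSpace ℝ (Fin 6)) (Fin.castSucc i)) ^ 2 + (y 5 - (EuclideanSpace.single 0 1 : EuclideanSpace ℝ (Fin 6)) 5) ^ 2 ≤ r ^ 2})) :
    Nonempty (M ≃ₘ⟮𝓡 4, 𝓡 4⟯ (Metric.sphere (0 : EuclideanSpace ℝ (Fin 5)) 1)) :=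
  nonempty_diffeomorph_of_ballMass hR Summit.SmoothPoincare4.SmoothPoincare4.Theorems.cylEntropy_slice₀_le_one
    M e ι hι hN hsep hΛ hmass

end Summit.SmoothPoincare4.SmoothPoincare4.Theorems.ThinCrossSectionExists.BallMassSlack

end
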